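import Mathlib
import Summits.ValiantsHypothesis.ValiantsHypothesis.Theses.BarrierLever
import Summits.ValiantsHypothesis.ValiantsHypothesis.Theorems.BarrierLeverPrincipalMinorLayoutsNonsingularRefutation
import Summits.ValiantsHypothesis.ValiantsHypothesis.Theorems.BarrierLeverTransversalSufficesForPrincipal
import Summits.ValiantsHypothesis.ValiantsHypothesis.Theorems.BarrierLeverPriorityPeelingDecidesTransversal
import Summits.ValiantsHypothesis.ValiantsHypothesis.Theorems.BarrierLeverPairMoveSound
import Summits.ValiantsHypothesis.ValiantsHypothesis.Theorems.BarrierLeverColumnShearSound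

/-!
# Route BarrierLever — item `PriorityPeelingCertificatesExist` (stmt-ValiantsHypothesis-19761): REFUTATION

Refutation file (`--workitem stmt-ValiantsHypothesis-19761`; cell valiant-natproofs, rung V4, 𝒟-side;
prover seat val-np-p3 gen 4). Definition-free; a corollary of the refutation of TNS
(`TNSRefutation.not_PrincipalMinorLayoutsNonsingular`, item 19126: at `h = 31` the layout
`u = (∅, {0}, …, {30})`, `w =` all subsets of `{0,…,4}` has a singular principal-minor layout
matrix for EVERY `K`) through arrows already in the tree.

**`not_PriorityPeelingCertificatesExist`**: priority-peeling certificates do NOT exist for every layout, since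
`PairMoveSound → ColumnShearSound → PriorityPeelingCertificatesExist → TT` (item 19766,
`PPGlue.priorityPeelingDecidesTransversal_route`) with `PairMoveSound` (19759) and `ColumnShearSound`
(19760) proved, TT ⇒ TNS (19153), and TNS false.

WHAT THIS IS NOT: item 19717 `PartitionMinorsHitByVP` (layout-dependent witnesses) is untouched;
nothing on crux stmt-14610 or `VP` vs `VNP`.
-/

set_option linter.dupNamespace false

namespace Summit.ValiantsHypothesis.ValiantsHypothesis.Theorems.BarrierLever.TNSRefutation

/-- **Priority-peeling certificates do not always exist** (item `PriorityPeelingCertificatesExist`,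
stmt-ValiantsHypothesis-19761): by the proved glue 19766 (with 19759, 19760), TT ⇒ TNS (19153) and the
refutation of TNS. -/
theorem not_PriorityPeelingCertificatesExist :
    ¬ Summit.ValiantsHypothesis.ValiantsHypothesis.Theses.BarrierLever.PriorityPeelingCertificatesExist :=
  fun hPP => not_PrincipalMinorLayoutsNonsingular
    (TransversalDictionary.transversalSufficesForPrincipal
      (PPGlue.priorityPeelingDecidesTransversal_route MarkedPairMove.pairMoveSound
        ColumnShear.columnShearSound hPP))

end Summit.ValiantsHypothesis.ValiantsHypothesis.Theorems.BarrierLever.TNSRefutation
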